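import Mathlib.NumberTheory.NumberField.Basic
import Mathlib.RingTheory.Localization.FractionRing
import Literature.NumberTheory.Automorphic.BrandtWeightClassFunction
import Literature.NumberTheory.Automorphic.BrandtModuleMultiplicativity
import HarnessLib

/-!
# Gross points: Heegner points of conductor `c` on a definite Shimura curve

Requested by the definition item `defn-GrossPointsThetaElement` (BSD ladder L1, "definite theta
exact order" line; cards `sum-versus-max-unbalanced-definite-theta-pfaffian`,
`sharp-auxiliary-field-eisenstein-theta`, `definite-class-group-gross-moment-certificate-v2`).
This is the first of three files (`GrossPoints`, `GrossPointsPicardAction`,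
`GrossPointsThetaElement`) and sets up, on top of the tree's Brandt-module file
`Literature.NumberTheory.Automorphic.BrandtXi` (setups `Brandt.XiSetup N⁺ N⁻` = a definite
quaternion algebra `D` of discriminant `N⁻` with an Eichler order `O` of level `N⁺`, the class
set `Cls O` of invertible right `O`-ideals modulo `I ∼ α I`, weights `w_c = |O_L(I_c)ˣ| / 2`),
the **Heegner points of conductor `c`** of Bertolini–Darmon, *Heegner points on Mumford–Tate
curves*, Invent. Math. 126 (1996), §2.1 — in the definite case also called **Gross points**
(Gross, *Heights and the special values of `L`-series* (1987), §3: "special points of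
discriminant `-D`", optimal embeddings `𝒪 → R_i` modulo `R_iˣ`).

## Dictionary with [BertoliniDarmon1996]

BD96 §1.3, §2.1 describe the definite Shimura curve and its CM points adelically:
`X = R̂ˣ \ (B̂ˣ × Hom(ℂ, B_∞)) / Bˣ`, Heegner points `(g × f)` with `f ∈ Hom(K, B)`, and the
conductor-`c` condition `f(K) ∩ (B ∩ g⁻¹ R̂ g) = f(𝒪_c)` ("`f` is an optimal embedding of the
order `𝒪_c` of conductor `c` into the Eichler order attached to the component of the point").
Since `B̂ˣ / Ôˣ` is the set of invertible (= locally principal, Voight Main Thm. 16.6.1) right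
fractional `O`-ideals `I = x Ô ∩ B`, whose component is the class `[I] ∈ Cls O` and whose
attached Eichler order is the left order `O_L(I) = x Ô x⁻¹ ∩ B`, we use the equivalent
ideal-theoretic model (the one of Gross 1987 §3 and of the tree's `BrandtXi`):

* `GrossRep D K`: pairs `(f, I)` of a `ℚ`-algebra embedding `f : K →ₐ[ℚ] D` and a `ℤ`-lattice
  `I ⊆ D`; the unit group `Dˣ` acts by `b • (f, I) = (b f b⁻¹, b I)` (`unitConj`);
* `GrossSpace D K := Dˣ \ GrossRep D K` (orbit quotient) — all "CM pairs" at once, of every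
  order `O` and conductor; `GrossSpace.mk`;
* `GrossRep.IsHeegner O c (f, I)`: `I` is an invertible right `O`-ideal with right order `O`
  (`Brandt.rightIdeals O`, so that `[I] ∈ Cls O`) and `f` is an **optimal embedding of the order
  of conductor `c`** into `O_L(I)`: `f x ∈ O_L(I) ↔ x ∈ 𝒪_c` (BD96 §2.1; Gross 1987 (3.3));
  here `𝒪_c = quadOrder K c = ℤ + c 𝓞_K` (Cox, *Primes of the form x² + ny²*, §7.A, Lemma 7.2);
* `grossPoints S K c ⊆ GrossSpace S.D K`: the images of the Heegner representatives — BD96's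
  set `H_{N⁺,N⁻}(K, c)` for the setup `S : Brandt.XiSetup N⁺ N⁻`; the predicate is
  `Dˣ`-invariant (`GrossRep.IsHeegner.units_smul_iff`), so `mk r ∈ grossPoints ↔ r.IsHeegner`
  (`mk_mem_grossPoints_iff`);
* the **lattice action** of the multiplicative monoid of `ℤ`-lattices `𝔞 ⊆ K` on pairs,
  `𝔞 • (f, I) = (f, f(𝔞) I)` (`GrossRep.latticeSMul`, a lawful monoid action commuting with
  `Dˣ`, `units_smul_lattice_smul`), descended to `GrossSpace` (`GrossSpace.latticeSMul`): its
  restriction to invertible `𝒪_c`-ideals is BD96's action (4) of `Pic(𝒪_c)`, §2.3, built in the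
  sequel file `GrossPointsPicardAction`;
* the value `yValue φ x = ⟨x, φ⟩ = w_[I] · φ [I] ∈ ℤ` of a vector `φ : Cls O → ℤ` of the Brandt
  module (a divisor class `Σ φ_c e_c` of `Pic X = ℤ[Cls O]`) on a point `x = [(f, I)]`, for
  Gross's pairing `⟨e_c, e_d⟩ = w_c δ_cd` (BD96 §1.4, §1.9: `φ_E^*(P) = ⟨P, v_f⟩`; Pollack–Weston
  2011 §2.1: `ψ_f(x) = ⟨x, g_f⟩`); junk value `0` off `Brandt.rightIdeals O`.

## Design notes

* Everything is stated for a general ring `D` with `Algebra ℚ D` where possible; the facts that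
  need arithmetic (`Dˣ` preserves invertible right ideals) are stated for a Brandt setup
  `S : Brandt.XiSetup N⁺ N⁻`, through the tree theorem
  `Brandt.units_smul_mem_rightIdeals_of_isTotallyDefinite`.
* `quadOrder K c` is defined for every field `K` (as the subring `ℤ + c 𝓞_K`); it is *the* order
  of conductor `c` when `K` is (imaginary) quadratic (`IsImaginaryQuadratic K` of the tree's
  `HeegnerPoints.lean` is the hypothesis under which the sequel files use it). `K` is a fraction
  field of it for `c ≠ 0` (`isFractionRing_quadOrder`), so Mathlib's `ClassGroup (quadOrder K c)`
  is its Picard group `Pic(𝒪_c)` (invertible fractional ideals modulo principal ones).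
* No finiteness, non-emptiness or counting statement is made here (BD96 Lemma 2.5:
  `#H(K, c) = 2^t · #Pic(𝒪_c)`, Eichler's theory of optimal embeddings); see the sequel files.
* Mathlib/tree searches: no `optimal embedding`, `Gross point`, `Heegner point of conductor`,
  `ring class`, order of conductor `c` (`lean search`); reused: `Brandt.rightIdeals`,
  `Brandt.leftOrder`, `Brandt.ClassSet`, `Brandt.weight`, `Brandt.mem_leftOrder_smul_iff`,
  `MulAction.orbitRel.Quotient`, `Submodule.pointwiseDistribMulAction`, `Submodule.map_mul`,
  `RingHom.toIntAlgHom`, `IsFractionRing.of_field`.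

## References

* [BertoliniDarmon1996] M. Bertolini, H. Darmon, *Heegner points on Mumford–Tate curves*,
  Invent. Math. 126 (1996) 413–456, §1.3–1.4, §1.9, §2.1, §2.3.
* [Gross1987] B. H. Gross, *Heights and the special values of `L`-series*, CMS Conf. Proc. 7
  (1987), §§1–3.
* [PollackWeston2011] R. Pollack, T. Weston, Compos. Math. 147 (2011), §2.1.
* [Voight2021] J. Voight, *Quaternion Algebras*, GTM 288, Def. 10.2.8, 16.5.1, 17.3.4, Main
  Thm. 16.6.1; D. A. Cox, *Primes of the form `x² + ny²`*, §7.A.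
-/

noncomputable section

open scoped Pointwise nonZeroDivisors
open NumberField Literature.NumberTheory.Automorphic

universe u v

namespace Literature.NumberTheory.EllipticCurves

/-! ### Orders of conductor `c` -/

section QuadOrder

variable (K : Type u) [Field K]

/-- The **order of conductor `c`**, `𝒪_c = ℤ + c 𝓞_K ⊆ K`: the subring of elements
`a + c y` (`a ∈ ℤ`, `y ∈ 𝓞_K`). For `K` quadratic this is the unique order of index `c` in the
maximal order `𝓞_K = ℤ[ω]`, `𝒪_c = ℤ[c ω]` (Cox §7.A, Lemma 7.2; BD96 §2.1: "`𝒪 = ℤ[c ω]`, where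
`c` is a positive integer called the conductor of `𝒪`"). Defined for every field `K` (then
merely a subring of `𝓞_K` containing `c 𝓞_K`); `𝒪_0 = ℤ`, `𝒪_1 = 𝓞_K` (`quadOrder_one`). [cite: BertoliniDarmon1996, §2.1] -/
def quadOrder (c : ℕ) : Subalgebra ℤ K where
  carrier := {x | ∃ a : ℤ, ∃ y : 𝓞 K, x = (a : K) + (c : K) * algebraMap (𝓞 K) K y}
  mul_mem' := by
    rintro _ _ ⟨a, y, rfl⟩ ⟨a', y', rfl⟩
    refine ⟨a * a', (a : 𝓞 K) * y' + (a' : 𝓞 K) * y + (c : 𝓞 K) * (y * y'), ?_⟩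
    simp only [map_add, map_mul, map_intCast, map_natCast, Int.cast_mul]
    ring
  one_mem' := ⟨1, 0, by simp⟩
  add_mem' := by
    rintro _ _ ⟨a, y, rfl⟩ ⟨a', y', rfl⟩
    exact ⟨a + a', y + y', by simp only [map_add, Int.cast_add]; ring⟩
  zero_mem' := ⟨0, 0, by simp⟩
  algebraMap_mem' r := ⟨r, 0, by simp⟩

variable {K}

/-- Membership in `𝒪_c` (definitional). [folklore] -/
theorem mem_quadOrder_iff {c : ℕ} {x : K} :
    x ∈ quadOrder K c ↔ ∃ a : ℤ, ∃ y : 𝓞 K, x = (a : K) + (c : K) * algebraMap (𝓞 K) K y :=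
  Iff.rfl

/-- `c y ∈ 𝒪_c` for `y ∈ 𝓞_K`: `c 𝓞_K ⊆ 𝒪_c`. [folklore] -/
theorem natCast_mul_mem_quadOrder (c : ℕ) (y : 𝓞 K) :
    (c : K) * algebraMap (𝓞 K) K y ∈ quadOrder K c :=
  ⟨0, y, by simp⟩

/-- `𝒪_d ⊆ 𝒪_c` when `c ∣ d`. [folklore] -/
theorem quadOrder_le_of_dvd {c d : ℕ} (h : c ∣ d) : quadOrder K d ≤ quadOrder K c := by
  rintro x ⟨a, y, rfl⟩
  obtain ⟨k, rfl⟩ := h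
  refine ⟨a, (k : 𝓞 K) * y, ?_⟩
  simp only [map_mul, map_natCast, Nat.cast_mul]
  ring

/-- Elements of `𝒪_c` are algebraic integers: `𝒪_c ⊆ 𝓞_K`. [folklore] -/
theorem isIntegral_of_mem_quadOrder {c : ℕ} {x : K} (hx : x ∈ quadOrder K c) :
    IsIntegral ℤ x := by
  obtain ⟨a, y, rfl⟩ := hx
  refine IsIntegral.add ?_ (IsIntegral.mul ?_ y.isIntegral_coe)
  · exact_mod_cast isIntegral_algebraMap (R := ℤ) (A := K) (x := a)
  · exact_mod_cast isIntegral_algebraMap (R := ℤ) (A := K) (x := (c : ℤ))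

/-- `𝒪_c ⊆ 𝓞_K`, as subalgebras of `K`. [folklore] -/
theorem quadOrder_le_integralClosure (c : ℕ) : quadOrder K c ≤ integralClosure ℤ K :=
  fun _ hx => isIntegral_of_mem_quadOrder hx

/-- `𝒪_1 = 𝓞_K`. [folklore] -/
theorem quadOrder_one : quadOrder K 1 = integralClosure ℤ K := by
  refine le_antisymm (quadOrder_le_integralClosure 1) fun x hx => ?_
  exact ⟨0, ⟨x, hx⟩, by simp⟩

/-- **`K` is the fraction field of `𝒪_c`** (`c ≠ 0`): every `z ∈ K` is `x / y` with
`x, y ∈ 𝓞_K`, hence `(c x) / (c y)` with `c x, c y ∈ 𝒪_c`. This makes Mathlib's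
`ClassGroup (quadOrder K c)` the Picard group `Pic(𝒪_c)`. [folklore] -/
instance isFractionRing_quadOrder [NumberField K] (c : ℕ) [NeZero c] :
    IsFractionRing (quadOrder K c) K := by
  refine IsFractionRing.of_field (quadOrder K c) K fun z => ?_
  obtain ⟨x, y, -, rfl⟩ := IsFractionRing.div_surjective (A := 𝓞 K) z
  have hc : (c : K) ≠ 0 := Nat.cast_ne_zero.mpr (NeZero.ne c)
  refine ⟨⟨(c : K) * algebraMap (𝓞 K) K x, natCast_mul_mem_quadOrder c x⟩,
    ⟨(c : K) * algebraMap (𝓞 K) K y, natCast_mul_mem_quadOrder c y⟩, ?_⟩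
  change _ = (c : K) * algebraMap (𝓞 K) K x / ((c : K) * algebraMap (𝓞 K) K y)
  rw [mul_div_mul_left _ _ hc]

end QuadOrder

/-! ### Conjugation by units -/

section Conj

variable {F : Type*} [CommSemiring F] {D : Type v} [Ring D] [Algebra F D]

/-- Conjugation `x ↦ b x b⁻¹` by a unit `b ∈ Dˣ`, as an `F`-algebra automorphism of `D`. [folklore] -/
def unitConj (b : Dˣ) : D →ₐ[F] D where
  toFun x := b * x * ↑b⁻¹
  map_one' := by simp
  map_mul' x y := by simp only [mul_assoc, Units.inv_mul_cancel_left]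
  map_zero' := by simp
  map_add' x y := by simp only [mul_add, add_mul]
  commutes' r := by rw [← Algebra.commutes, mul_assoc, Units.mul_inv, mul_one]

/-- `unitConj b x = b x b⁻¹` (definitional). [folklore] -/
@[simp] theorem unitConj_apply (b : Dˣ) (x : D) : unitConj (F := F) b x = b * x * ↑b⁻¹ := rfl

/-- Conjugation by `1` is the identity. [folklore] -/
theorem unitConj_one : unitConj (F := F) (1 : Dˣ) = AlgHom.id F D := by
  ext x; simp

/-- Conjugation is multiplicative: `(ab) x (ab)⁻¹ = a (b x b⁻¹) a⁻¹`. [folklore] -/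
theorem unitConj_mul (a b : Dˣ) :
    unitConj (F := F) (a * b) = (unitConj a).comp (unitConj b) := by
  ext x; simp [mul_assoc]

end Conj

/-! ### CM pairs `(f, I)` and the action of `Dˣ` -/

section Pairs

variable (D : Type v) [Ring D] [Algebra ℚ D] (K : Type u) [Field K] [NumberField K]

/-- A **CM pair** `(f, I)`: an embedding `f : K →ₐ[ℚ] D` of the quadratic field into the
quaternion algebra together with a `ℤ`-lattice `I ⊆ D` — a representative of a point of the
definite Shimura set over `K` (BD96 §2.1: "`(g × f) ∈ B̂ˣ × Hom(K, B)`", with the right ideal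
`I = g Ô ∩ B` in place of the coset `g Ôˣ`). [cite: BertoliniDarmon1996, §2.1] -/
@[ext] structure GrossRep where
  /-- The embedding `K → D`. -/
  emb : K →ₐ[ℚ] D
  /-- The lattice (an invertible right `O`-ideal for Heegner representatives). -/
  lat : Submodule ℤ D

variable {D K}

namespace GrossRep

/-- `Dˣ` acts on CM pairs by `b • (f, I) = (b f b⁻¹, b I)` (BD96 §1.3, §2.1: the quotient by
`Bˣ`). [cite: BertoliniDarmon1996, §2.1] -/
instance unitsMulAction : MulAction Dˣ (GrossRep D K) where
  smul b r := ⟨(unitConj b).comp r.emb, b • r.lat⟩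
  one_smul r := by
    change (⟨(unitConj 1).comp r.emb, (1 : Dˣ) • r.lat⟩ : GrossRep D K) = r
    rw [unitConj_one, AlgHom.id_comp, one_smul]
  mul_smul a b r := by
    change (⟨(unitConj (a * b)).comp r.emb, (a * b) • r.lat⟩ : GrossRep D K) =
      ⟨(unitConj a).comp ((unitConj b).comp r.emb), a • b • r.lat⟩
    rw [unitConj_mul, AlgHom.comp_assoc, mul_smul]

/-- The embedding of `b • (f, I)` is `b f b⁻¹`. [folklore] -/
@[simp] theorem units_smul_emb (b : Dˣ) (r : GrossRep D K) :
    (b • r).emb = (unitConj b).comp r.emb := rfl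

/-- The lattice of `b • (f, I)` is `b I`. [folklore] -/
@[simp] theorem units_smul_lat (b : Dˣ) (r : GrossRep D K) : (b • r).lat = b • r.lat := rfl

/-! #### The lattice action `𝔞 • (f, I) = (f, f(𝔞) I)` -/

/-- The image `f(𝔞) ⊆ D` of a `ℤ`-lattice `𝔞 ⊆ K` under the embedding `f`, a `ℤ`-submodule
of `D`. [folklore] -/
def embLattice (f : K →ₐ[ℚ] D) (𝔞 : Submodule ℤ K) : Submodule ℤ D :=
  𝔞.map f.toRingHom.toIntAlgHom.toLinearMap

/-- Membership in `f(𝔞)`. [folklore] -/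
theorem mem_embLattice_iff {f : K →ₐ[ℚ] D} {𝔞 : Submodule ℤ K} {x : D} :
    x ∈ embLattice f 𝔞 ↔ ∃ a ∈ 𝔞, f a = x :=
  Submodule.mem_map

/-- `f(a) ∈ f(𝔞)` for `a ∈ 𝔞`. [folklore] -/
theorem apply_mem_embLattice (f : K →ₐ[ℚ] D) {𝔞 : Submodule ℤ K} {a : K} (ha : a ∈ 𝔞) :
    f a ∈ embLattice f 𝔞 :=
  mem_embLattice_iff.mpr ⟨a, ha, rfl⟩

/-- `f(ℤ · 1) = ℤ · 1`. [folklore] -/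
theorem embLattice_one (f : K →ₐ[ℚ] D) : embLattice f 1 = 1 :=
  Submodule.map_one _

/-- `f(𝔞 𝔟) = f(𝔞) f(𝔟)`. [folklore] -/
theorem embLattice_mul (f : K →ₐ[ℚ] D) (𝔞 𝔟 : Submodule ℤ K) :
    embLattice f (𝔞 * 𝔟) = embLattice f 𝔞 * embLattice f 𝔟 :=
  Submodule.map_mul _ _ _

/-- `(b f b⁻¹)(𝔞) = b f(𝔞) b⁻¹`, i.e. the image of `f(𝔞)` under conjugation. [folklore] -/
theorem embLattice_unitConj_comp (b : Dˣ) (f : K →ₐ[ℚ] D) (𝔞 : Submodule ℤ K) :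
    embLattice ((unitConj b).comp f) 𝔞 =
      (embLattice f 𝔞).map (unitConj (F := ℚ) b).toRingHom.toIntAlgHom.toLinearMap := by
  rw [embLattice, embLattice, ← Submodule.map_comp]
  rfl

/-- The **lattice action**: the multiplicative monoid of `ℤ`-lattices `𝔞 ⊆ K` acts on CM pairs
by `𝔞 • (f, I) = (f, f(𝔞) I)` (product of lattices in `D`). For `𝔞` an invertible ideal of the
order `𝒪_c` and `(f, I)` a Heegner representative of conductor `c` this is BD96's action (4) of
`Pic(𝒪_c)`, `σ (g × f) = (g f̂(σ) × f)`, §2.3. [cite: BertoliniDarmon1996, §2.3 (4)] -/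
instance latticeSMul : MulAction (Submodule ℤ K) (GrossRep D K) where
  smul 𝔞 r := ⟨r.emb, embLattice r.emb 𝔞 * r.lat⟩
  one_smul r := by
    change (⟨r.emb, embLattice r.emb 1 * r.lat⟩ : GrossRep D K) = r
    rw [embLattice_one, one_mul]
  mul_smul 𝔞 𝔟 r := by
    change (⟨r.emb, embLattice r.emb (𝔞 * 𝔟) * r.lat⟩ : GrossRep D K) =
      ⟨r.emb, embLattice r.emb 𝔞 * (embLattice r.emb 𝔟 * r.lat)⟩
    rw [embLattice_mul, mul_assoc]

/-- The embedding of `𝔞 • (f, I)` is `f`. [folklore] -/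
@[simp] theorem lattice_smul_emb (𝔞 : Submodule ℤ K) (r : GrossRep D K) : (𝔞 • r).emb = r.emb :=
  rfl

/-- The lattice of `𝔞 • (f, I)` is `f(𝔞) I`. [folklore] -/
@[simp] theorem lattice_smul_lat (𝔞 : Submodule ℤ K) (r : GrossRep D K) :
    (𝔞 • r).lat = embLattice r.emb 𝔞 * r.lat :=
  rfl

/-- `b (X I) = (b X b⁻¹) (b I)` for lattices `X, I ⊆ D` and `b ∈ Dˣ`. [folklore] -/
theorem units_smul_mul_eq (b : Dˣ) (X I : Submodule ℤ D) :
    b • (X * I) = X.map (unitConj (F := ℚ) b).toRingHom.toIntAlgHom.toLinearMap * b • I := by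
  apply le_antisymm
  · intro z hz
    obtain ⟨w, hw, rfl⟩ := (Submodule.mem_smul_pointwise_iff_exists _ _ _).mp hz
    refine Submodule.mul_induction_on hw (fun x hx y hy => ?_) (fun z w hz hw => ?_)
    · have : b • (x * y) = (b * x * ↑b⁻¹) * (b • y) := by
        simp [Units.smul_def, mul_assoc]
      rw [this]
      exact Submodule.mul_mem_mul ⟨x, hx, rfl⟩ (Submodule.smul_mem_pointwise_smul y b I hy)
    · rw [smul_add]
      exact Submodule.add_mem _ hz hw
  · rw [Submodule.mul_le]
    rintro _ ⟨x, hx, rfl⟩ _ hy'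
    obtain ⟨y, hy, rfl⟩ := (Submodule.mem_smul_pointwise_iff_exists _ _ _).mp hy'
    have : (unitConj (F := ℚ) b).toRingHom.toIntAlgHom.toLinearMap x * b • y = b • (x * y) := by
      simp [Units.smul_def, mul_assoc]
    rw [this]
    exact Submodule.smul_mem_pointwise_smul _ b _ (Submodule.mul_mem_mul hx hy)

/-- **The two actions commute**: `b • (𝔞 • (f, I)) = 𝔞 • (b • (f, I))`, i.e.
`b f(𝔞) I = (b f b⁻¹)(𝔞) · b I`. [folklore] -/
theorem units_smul_lattice_smul (b : Dˣ) (𝔞 : Submodule ℤ K) (r : GrossRep D K) :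
    b • (𝔞 • r) = 𝔞 • (b • r) := by
  ext : 1
  · rfl
  · change b • (embLattice r.emb 𝔞 * r.lat) = embLattice ((unitConj b).comp r.emb) 𝔞 * b • r.lat
    rw [units_smul_mul_eq, embLattice_unitConj_comp]

/-! #### Heegner representatives of conductor `c` -/

/-- `(f, I)` is a **Heegner representative of conductor `c`** for the order `O ⊆ D`: `I` is an
invertible right `O`-ideal with right order `O` (`Brandt.rightIdeals O`, so that its class `[I]`
lies in `Cls O`) and `f` is an **optimal embedding of `𝒪_c` into the left order `O_L(I)`**:
`f(K) ∩ O_L(I) = f(𝒪_c)`, i.e. `f x ∈ O_L(I) ↔ x ∈ 𝒪_c` (BD96 §2.1: "`f(K) ∩ g⁻¹ R̂ g = f(𝒪)` …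
We call `f` an optimal embedding of `𝒪` into the Eichler order"; Gross 1987 §3). [cite: BertoliniDarmon1996, §2.1] -/
def IsHeegner (O : Submodule ℤ D) (c : ℕ) (r : GrossRep D K) : Prop :=
  r.lat ∈ Brandt.rightIdeals O ∧ ∀ x : K, r.emb x ∈ Brandt.leftOrder r.lat ↔ x ∈ quadOrder K c

/-- The optimality clause is invariant under `Dˣ`: `(b f b⁻¹)(x) ∈ O_L(b I) ↔ f x ∈ O_L(I)`
(`Brandt.mem_leftOrder_smul_iff`: `O_L(b I) = b O_L(I) b⁻¹`). [folklore] -/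
theorem units_smul_emb_mem_leftOrder_iff (b : Dˣ) (r : GrossRep D K) (x : K) :
    (b • r).emb x ∈ Brandt.leftOrder (b • r).lat ↔ r.emb x ∈ Brandt.leftOrder r.lat := by
  rw [units_smul_emb, units_smul_lat, Brandt.mem_leftOrder_smul_iff, AlgHom.comp_apply,
    unitConj_apply]
  simp only [← mul_assoc, Units.inv_mul, one_mul, Units.inv_mul_cancel_right]

end GrossRep

/-! ### The Gross space `Dˣ \ {(f, I)}` and its Heegner points -/

variable (D K) in
/-- The **Gross space** of `D` over `K`: CM pairs `(f, I)` modulo `b • (f, I) = (b f b⁻¹, b I)`,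
`b ∈ Dˣ` (the orbit quotient). Its Heegner points of conductor `c` for a Brandt setup are
`grossPoints`; BD96 §2.1 (definite case): the CM points of `X_{N⁺,N⁻}` over `K`. [cite: BertoliniDarmon1996, §2.1] -/
def GrossSpace : Type (max u v) := MulAction.orbitRel.Quotient Dˣ (GrossRep D K)

namespace GrossSpace

/-- The point `[(f, I)]` of a CM pair. [folklore] -/
def mk (r : GrossRep D K) : GrossSpace D K := Quotient.mk (MulAction.orbitRel Dˣ (GrossRep D K)) r

/-- Every point has a representative. [folklore] -/
theorem mk_surjective : Function.Surjective (mk : GrossRep D K → GrossSpace D K) :=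
  Quotient.mk_surjective

/-- `[(f, I)] = [(f', I')] ↔ (f, I) = b • (f', I')` for some `b ∈ Dˣ`. [folklore] -/
theorem mk_eq_mk_iff {r r' : GrossRep D K} : mk r = mk r' ↔ ∃ b : Dˣ, b • r' = r := by
  constructor
  · intro h
    exact MulAction.mem_orbit_iff.mp (MulAction.orbitRel_apply.mp (Quotient.exact h))
  · rintro ⟨b, rfl⟩
    exact Quotient.sound (MulAction.orbitRel_apply.mpr (MulAction.mem_orbit _ b))

/-- `[b • (f, I)] = [(f, I)]`. [folklore] -/
@[simp] theorem mk_units_smul (b : Dˣ) (r : GrossRep D K) : mk (b • r) = mk r :=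
  mk_eq_mk_iff.mpr ⟨b, rfl⟩

/-- Induction on points through representatives. [folklore] -/
@[elab_as_elim]
theorem ind {P : GrossSpace D K → Prop} (h : ∀ r, P (mk r)) (x : GrossSpace D K) : P x :=
  Quotient.ind h x

/-- The **lattice action on points**: `𝔞 • [(f, I)] = [(f, f(𝔞) I)]`, well defined because it
commutes with `Dˣ` (`GrossRep.units_smul_lattice_smul`). [cite: BertoliniDarmon1996, §2.3 (4)] -/
instance latticeSMul : MulAction (Submodule ℤ K) (GrossSpace D K) where
  smul 𝔞 := Quotient.map' (𝔞 • ·) fun a b h => by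
    obtain ⟨g, rfl⟩ := MulAction.orbitRel_apply.mp h
    exact MulAction.orbitRel_apply.mpr ⟨g, GrossRep.units_smul_lattice_smul g 𝔞 b⟩
  one_smul x := by
    induction x using ind with
    | h r => exact congrArg mk (one_smul _ r)
  mul_smul 𝔞 𝔟 x := by
    induction x using ind with
    | h r => exact congrArg mk (mul_smul 𝔞 𝔟 r)

/-- `𝔞 • [(f, I)] = [𝔞 • (f, I)]` (definitional). [folklore] -/
@[simp] theorem lattice_smul_mk (𝔞 : Submodule ℤ K) (r : GrossRep D K) : 𝔞 • mk r = mk (𝔞 • r) :=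
  rfl

end GrossSpace

/-! ### Heegner points of a Brandt setup and the value `⟨x, φ⟩` -/

section Setup

variable {Nplus Nminus : ℕ}

/-- For a Brandt setup, `Dˣ` preserves the Heegner representatives of conductor `c`: `b I` is
again an invertible right `O`-ideal (`Brandt.units_smul_mem_rightIdeals_of_isTotallyDefinite`)
and `O_L(b I) = b O_L(I) b⁻¹`. [folklore] -/
theorem GrossRep.IsHeegner.units_smul_iff (S : Brandt.XiSetup Nplus Nminus) (c : ℕ) (b : S.Dˣ)
    (r : GrossRep S.D K) : (b • r).IsHeegner S.O c ↔ r.IsHeegner S.O c := by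
  have key : ∀ (b : S.Dˣ) (r : GrossRep S.D K), r.IsHeegner S.O c → (b • r).IsHeegner S.O c :=
    fun b r h => ⟨Brandt.units_smul_mem_rightIdeals_of_isTotallyDefinite S.isTotallyDefinite
      S.isEichlerOrder.isOrder h.1 b,
      fun x => (GrossRep.units_smul_emb_mem_leftOrder_iff b r x).trans (h.2 x)⟩
  refine ⟨fun h => ?_, key b r⟩
  have := key b⁻¹ (b • r) h
  rwa [inv_smul_smul] at this

variable (K) in
/-- **The Gross points (Heegner points) of conductor `c`** of the setup `S = (D, O)` over `K`:
the points `[(f, I)]` with `I` an invertible right `O`-ideal and `f` an optimal embedding of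
`𝒪_c` into `O_L(I)` — BD96's `H_{N⁺,N⁻}(K, c)` ("the set of Heegner points of conductor `c` on
`X_{N⁺,N⁻}`", §2.1), Gross's special points of discriminant `disc 𝒪_c` (1987, §3). Non-empty
iff every prime dividing `N⁺` splits and every prime dividing `N⁻` is inert in `K`, for `c`
prime to `N⁺N⁻` (BD96 Lemma 2.1 — not proved here). [cite: BertoliniDarmon1996, §2.1] -/
def grossPoints (S : Brandt.XiSetup Nplus Nminus) (c : ℕ) : Set (GrossSpace S.D K) :=
  {x | ∃ r : GrossRep S.D K, GrossSpace.mk r = x ∧ r.IsHeegner S.O c}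

/-- `[(f, I)]` is a Gross point of conductor `c` iff `(f, I)` is a Heegner representative of
conductor `c` (the predicate is `Dˣ`-invariant). [folklore] -/
theorem mk_mem_grossPoints_iff {S : Brandt.XiSetup Nplus Nminus} {c : ℕ} {r : GrossRep S.D K} :
    GrossSpace.mk r ∈ grossPoints K S c ↔ r.IsHeegner S.O c := by
  refine ⟨?_, fun h => ⟨r, rfl, h⟩⟩
  rintro ⟨r', hr', h'⟩
  obtain ⟨b, rfl⟩ := GrossSpace.mk_eq_mk_iff.mp hr'.symm
  exact (GrossRep.IsHeegner.units_smul_iff S c b r').mpr h'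

/-- The value `⟨(f, I), φ⟩ := w_[I] · φ [I]` of a Brandt-module vector `φ : Cls O → ℤ` (the
divisor class `Σ_c φ_c e_c`) on a representative, for Gross's pairing `⟨e_c, e_d⟩ = w_c δ_cd`
(BD96 §1.4 and §1.9: `φ_E^*(D) = ⟨D, v_f⟩`; Pollack–Weston 2011 §2.1: `ψ_f = ⟨·, g_f⟩`). Junk
value `0` if `I ∉ Brandt.rightIdeals O` (no class). [cite: BertoliniDarmon1996, §1.9] -/
def GrossRep.yValue (O : Submodule ℤ D) (φ : Brandt.ClassSet O → ℤ) (r : GrossRep D K) : ℤ :=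
  open scoped Classical in
  if h : r.lat ∈ Brandt.rightIdeals O then
    (Brandt.weight O (Quotient.mk (Brandt.rightClassSetoid O) ⟨r.lat, h⟩) : ℤ) *
      φ (Quotient.mk (Brandt.rightClassSetoid O) ⟨r.lat, h⟩)
  else 0

/-- `⟨(f, I), φ⟩ = w_[I] φ_[I]` when `I` is an invertible right `O`-ideal. [folklore] -/
theorem GrossRep.yValue_eq {O : Submodule ℤ D} (φ : Brandt.ClassSet O → ℤ) {r : GrossRep D K}
    (h : r.lat ∈ Brandt.rightIdeals O) :
    r.yValue O φ = (Brandt.weight O (Quotient.mk (Brandt.rightClassSetoid O) ⟨r.lat, h⟩) : ℤ) *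
      φ (Quotient.mk (Brandt.rightClassSetoid O) ⟨r.lat, h⟩) := by
  rw [GrossRep.yValue, dif_pos h]

/-- `⟨(f, I), φ⟩ = 0` (junk) when `I` is not an invertible right `O`-ideal. [folklore] -/
theorem GrossRep.yValue_of_not_mem {O : Submodule ℤ D} (φ : Brandt.ClassSet O → ℤ)
    {r : GrossRep D K} (h : r.lat ∉ Brandt.rightIdeals O) : r.yValue O φ = 0 := by
  rw [GrossRep.yValue, dif_neg h]

/-- `⟨b • (f, I), φ⟩ = ⟨(f, I), φ⟩` for a setup: `[b I] = [I]` in `Cls O`. [folklore] -/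
theorem GrossRep.yValue_units_smul (S : Brandt.XiSetup Nplus Nminus) (φ : Brandt.ClassSet S.O → ℤ)
    (b : S.Dˣ) (r : GrossRep S.D K) : (b • r).yValue S.O φ = r.yValue S.O φ := by
  by_cases h : r.lat ∈ Brandt.rightIdeals S.O
  · have hb : (b • r).lat ∈ Brandt.rightIdeals S.O :=
      Brandt.units_smul_mem_rightIdeals_of_isTotallyDefinite S.isTotallyDefinite
        S.isEichlerOrder.isOrder h b
    have hcls : (Quotient.mk (Brandt.rightClassSetoid S.O) ⟨(b • r).lat, hb⟩ :
        Brandt.ClassSet S.O) = Quotient.mk (Brandt.rightClassSetoid S.O) ⟨r.lat, h⟩ :=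
      Quotient.sound ⟨b⁻¹, by simp⟩
    rw [GrossRep.yValue_eq φ hb, GrossRep.yValue_eq φ h, hcls]
  · have hb : (b • r).lat ∉ Brandt.rightIdeals S.O := fun hb => h <| by
      have := Brandt.units_smul_mem_rightIdeals_of_isTotallyDefinite S.isTotallyDefinite
        S.isEichlerOrder.isOrder hb b⁻¹
      rwa [GrossRep.units_smul_lat, inv_smul_smul] at this
    rw [GrossRep.yValue_of_not_mem φ hb, GrossRep.yValue_of_not_mem φ h]

/-- **`⟨x, φ⟩ = w_[I] φ_[I]` on points** `x = [(f, I)]` of the Gross space of a setup (BD96 §1.9: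
the map `φ_E^* : Pic X → ℤ`, `D ↦ ⟨D, v_f⟩`, evaluated on a CM point; this is also the value at
the component of `x` of the quaternionic eigenform `i ↦ w_i φ_i` attached to the divisor `φ`).
[cite: BertoliniDarmon1996, §1.9] -/
def GrossSpace.yValue (S : Brandt.XiSetup Nplus Nminus) (φ : Brandt.ClassSet S.O → ℤ) :
    GrossSpace S.D K → ℤ :=
  Quotient.lift (GrossRep.yValue S.O φ) fun a b h => by
    obtain ⟨g, rfl⟩ := MulAction.orbitRel_apply.mp h
    exact GrossRep.yValue_units_smul S φ g b

/-- `⟨[(f, I)], φ⟩ = ⟨(f, I), φ⟩` (definitional). [folklore] -/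
@[simp] theorem GrossSpace.yValue_mk (S : Brandt.XiSetup Nplus Nminus)
    (φ : Brandt.ClassSet S.O → ℤ) (r : GrossRep S.D K) :
    GrossSpace.yValue S φ (GrossSpace.mk r) = r.yValue S.O φ :=
  rfl

end Setup

end Pairs

end Literature.NumberTheory.EllipticCurves

end
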